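import Summits.QuantumFields.YangMills.Theorems.MirrorModularBoostsSoftKernelBoostCovarianceSlotProductExpansion

/-!
# Slot-product expansion with ONE support point per term — stub `stub_slotProductExpansionJoint` (T4a-joint)

Line `Sketch` of crux `MirrorModularBoosts.SoftKernelBoostCovariance` (stmt-QuantumFields-14999); pure analysis on `𝓢((ℝ⁴)ⁿ)`.

**Statement.**  Verbatim the landed per-slot stub `stub_slotProductExpansion` (T4a, file
`MirrorModularBoostsSoftKernelBoostCovarianceSlotProductExpansion`), except that the localisation of the planar centres is
JOINT over the slots: for every term `i` of the approximating sum there is ONE point `x ∈ supp F` with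
`|cᵢⱼ - x_j^{pl}| ≤ δ` for ALL slots `j` simultaneously.

**Proof.**  The construction of the landed proof, steps (1)–(4) of that file's module docstring, whose helpers are imported:
scaled slot coordinates `Λ = (3/δ)·` (`exists_slotCoordEquiv`), the finite localisation `F = ∑_{β ∈ B} η_β F` with, for each
`β ∈ B`, a point `x_β ∈ supp F` whose ALL `4n` scaled coordinates are within `1` of `β` (`exists_finset_eq_sum_eta`), the
slot factorisation of the elementary functions `e_{β,k}` with planar factors supported within `2` scaled units of `β`'s
slot-`j` planar coordinates (`exists_slotFactors`), truncation, radialisation by the hypothesis (T4b) with one normalised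
profile (`exists_normalisedRadialBump`, `exists_seminorm_control`, `continuous_slotProduct`), multiplying out.  The only
change is the localisation witness: a term `i` comes from one pair `(β, k)`, its centres `cᵢⱼ` lie in the supports of the
planar factors of `e_{β,k}`, hence within `2 + 1 = 3` scaled units `= δ` of the planar slot coordinates of the SAME `x_β`,
for every `j`.
-/

noncomputable section

namespace Summit.QuantumFields.YangMills.Theorems.SoftKernelBoostCovariance.Sketch

open scoped InnerProductSpace SchwartzMap ContDiff
open MeasureTheory Filter Topology Set Literature.MathematicalPhysics.QuantumLattice Literature.MathematicalPhysics.AQFT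
  Literature.MathematicalPhysics.QuantumFieldTheory
open Summit.QuantumFields.YangMills.Theorems.NPointIsotropy.Negative (E4)

/-- **Stub (T4a-joint) of line `Sketch`: slot-product expansion with ONE support point per term.**  For a compactly
supported `F ∈ 𝓢((ℝ⁴)ⁿ)` and `δ > 0` there are `A, M` such that for every finite seminorm set `s`, `η > 0` and all small
radii `ρ`, `F` is `η`-close to a finite sum `∑ λᵢ Tᵢ` of slot products of ONE radial planar bump of radius `ρ` with
transverse profiles bounded by `A` in `L¹ ∩ L^∞` and `∑ |λᵢ| ≤ M`, where for each term `i` ONE point `x ∈ supp F` has all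
its planar slot coordinates within `δ` of the centres `cᵢⱼ`; assuming the radial Riemann approximation in `𝓢(ℝ²)` (first
hypothesis, stub T4b).  Proof: module docstring. -/
theorem stub_slotProductExpansionJoint :
    open Literature.MathematicalPhysics.QuantumLattice Literature.MathematicalPhysics.AQFT
      Literature.MathematicalPhysics.QuantumFieldTheory
      Summit.QuantumFields.YangMills.Theorems.CurvatureBoostCovariance.Negative
      Summit.QuantumFields.YangMills.Theorems.NPointIsotropy.Negative in
    (∀ (a : SchwartzMap (ℝ × ℝ) ℂ), HasCompactSupport (a : ℝ × ℝ → ℂ) →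
      ∀ (s : Finset (ℕ × ℕ)) (η : ℝ), 0 < η →
        ∃ ρ₀ : ℝ, 0 < ρ₀ ∧ ∀ ρ : ℝ, 0 < ρ → ρ ≤ ρ₀ →
          ∀ (φ : ℝ → ℂ) (G : SchwartzMap (ℝ × ℝ) ℂ),
            (∀ r : ℝ, ρ ^ 2 < r → φ r = 0) →
            (∀ p : ℝ × ℝ, G p = φ (p.1 ^ 2 + p.2 ^ 2)) →
            (∀ p : ℝ × ℝ, 0 ≤ (G p).re ∧ (G p).im = 0) →
            (∫ p : ℝ × ℝ, G p) = 1 →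
            ∃ (I : ℕ) (y : Fin I → ℝ × ℝ) (κ : Fin I → ℂ) (g : Fin I → SchwartzMap (ℝ × ℝ) ℂ),
              (∀ (i : Fin I) (p : ℝ × ℝ), g i p = φ ((p.1 - (y i).1) ^ 2 + (p.2 - (y i).2) ^ 2)) ∧
              (∀ i : Fin I, y i ∈ tsupport (a : ℝ × ℝ → ℂ)) ∧
              (∑ i, ‖κ i‖ ≤ (∫ p : ℝ × ℝ, ‖a p‖) + 1) ∧
              (∀ kl ∈ s, SchwartzMap.seminorm ℝ kl.1 kl.2 (a - ∑ i, κ i • g i) < η)) →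
    ∀ (n : ℕ) (F : SchwartzMap (Fin n → E4) ℂ), HasCompactSupport (F : (Fin n → E4) → ℂ) →
      ∀ δ : ℝ, 0 < δ →
        ∃ (A M : ℝ), ∀ (s : Finset (ℕ × ℕ)) (η : ℝ), 0 < η →
          ∃ ρ₀ : ℝ, 0 < ρ₀ ∧ ∀ ρ : ℝ, 0 < ρ → ρ ≤ ρ₀ →
            ∃ (φ : ℝ → ℂ) (I : ℕ) (c : Fin I → Fin n → ℝ × ℝ) (hh : Fin I → Fin n → ℝ × ℝ → ℂ)
              (f0 : Fin I → Fin n → SchwartzMap (Fin 1 → E4) ℂ)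
              (lam : Fin I → ℂ) (T : Fin I → SchwartzMap (Fin n → E4) ℂ),
              (∀ r : ℝ, ρ ^ 2 < r → φ r = 0) ∧
              MeasureTheory.Integrable (fun p : ℝ × ℝ => φ (p.1 ^ 2 + p.2 ^ 2)) ∧
              (∫ p : ℝ × ℝ, ‖φ (p.1 ^ 2 + p.2 ^ 2)‖) ≤ 1 ∧
              (∀ (i : Fin I) (j : Fin n) (x : Fin 1 → E4),
                f0 i j x = φ ((x 0 0) ^ 2 + (x 0 1) ^ 2) * hh i j (x 0 2, x 0 3)) ∧
              (∀ (i : Fin I) (x : Fin n → E4),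
                T i x = ∏ j, φ ((x j 0 - (c i j).1) ^ 2 + (x j 1 - (c i j).2) ^ 2) * hh i j (x j 2, x j 3)) ∧
              (∀ i : Fin I, ∃ x ∈ tsupport (F : (Fin n → E4) → ℂ), ∀ j : Fin n,
                |(c i j).1 - x j 0| ≤ δ ∧ |(c i j).2 - x j 1| ≤ δ) ∧
              (∀ (i : Fin I) (j : Fin n), MeasureTheory.Integrable (hh i j) ∧
                (∫ p : ℝ × ℝ, ‖hh i j p‖) ≤ A ∧ ∀ p : ℝ × ℝ, ‖hh i j p‖ ≤ A) ∧
              (∑ i, ‖lam i‖ ≤ M) ∧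
              (∀ kl ∈ s, SchwartzMap.seminorm ℝ kl.1 kl.2 (F - ∑ i, lam i • T i) < η) := by
  intro hRR n F hF δ hδ
  have hσ : (0 : ℝ) < 3 / δ := by positivity
  obtain ⟨Λ, hΛ⟩ := exists_slotCoordEquiv n hσ.ne'
  obtain ⟨B, hFB, hBloc⟩ := exists_finset_eq_sum_eta Λ F hF
  choose a b hfac hacs hats haL hb using exists_slotFactors n hσ Λ hΛ
  obtain ⟨M₁, hM₁⟩ := exists_sum_norm_coeff_le Λ F
  -- the slot products on `(ℝ⁴)ⁿ`
  have hC : ∃ C₀ : ℝ, ∀ x : E4, ‖x‖ ≤ C₀ * max ‖((EuclideanSpace.proj 0).prod (EuclideanSpace.proj 1) : E4 →L[ℝ] ℝ × ℝ) x‖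
      ‖((EuclideanSpace.proj 2).prod (EuclideanSpace.proj 3) : E4 →L[ℝ] ℝ × ℝ) x‖ :=
    ⟨_, fun x => EuclideanSpace.norm_le_sqrt_card_mul x (by positivity) fun i => by fin_cases i <;> simp [Prod.norm_def]⟩
  obtain ⟨Φ, hΦ, hΦc⟩ : ∃ Φ : (Fin n → 𝓢(ℝ × ℝ, ℂ)) → (Fin n → 𝓢(ℝ × ℝ, ℂ)) → 𝓢((Fin n → E4), ℂ),
      (∀ u v x, Φ u v x = ∏ j, u j (x j 0, x j 1) * v j (x j 2, x j 3)) ∧ ∀ v, Continuous fun u => Φ u v :=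
    ⟨fun u v => SchwartzMap.tensorFin n fun j => (u j).mulComp (v j) _ _ hC, fun u v x => by simp, continuous_slotProduct _ _ hC n⟩
  have hE : ∀ β k, NuclearExpansion.e Λ β k = Φ (a β k) (b β k) := fun β k => by ext y; rw [hfac, hΦ]
  set A₀ : ℝ := (4 / (3 / δ)) ^ 2
  refine ⟨max A₀ 1, B.card * M₁ * (A₀ + 1) ^ n, fun s η hη => ?_⟩
  set q : Seminorm ℂ 𝓢((Fin n → E4), ℂ) := s.sup (schwartzSeminormFamily ℂ (Fin n → E4) ℂ)
  -- (2) truncation of the box Fourier series of the finitely many localised pieces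
  obtain ⟨K, hK⟩ : ∃ K : Finset (Fin (n * 4) → ℤ),
      q (F - ∑ p ∈ B ×ˢ K, NuclearExpansion.coeff Λ p.1 p.2 F • NuclearExpansion.e Λ p.1 p.2) < η / 2 := by
    have h := tendsto_finsetSum B fun β _ => NuclearExpansion.hasSum_coeff_smul_e Λ β F
    rw [← hFB, (schwartz_withSeminorms ℂ (Fin n → E4) ℂ).tendsto_nhds'] at h
    obtain ⟨K, hK⟩ := Filter.eventually_atTop.1 (by simpa only [SummationFilter.unconditional_filter] using h s _ (half_pos hη))
    exact ⟨K, by rw [map_sub_rev, Finset.sum_product]; exact hK K le_rfl⟩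
  set P : Finset ((Fin (n * 4) → ℤ) × (Fin (n * 4) → ℤ)) := B ×ˢ K
  -- (3) tolerances for the radialisation of the planar factors, thresholds of (T4b), the common profile
  set Ct : ℝ := ∑ p ∈ P, ‖NuclearExpansion.coeff Λ p.1 p.2 F‖
  have hCt0 : 0 ≤ Ct := Finset.sum_nonneg fun _ _ => norm_nonneg _
  have hε : 0 < η / 2 / (Ct + 1) := div_pos (half_pos hη) (by linarith)
  choose s' η' hη' hclose using fun p : (Fin (n * 4) → ℤ) × (Fin (n * 4) → ℤ) =>
    exists_seminorm_control (hΦc (b p.1 p.2)) (a p.1 p.2) s hε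
  choose ρf hρf hitems using fun (p : (Fin (n * 4) → ℤ) × (Fin (n * 4) → ℤ)) (j : Fin n) =>
    hRR (a p.1 p.2 j) (hacs p.1 p.2 j) (s' p j) (η' p j) (hη' p j)
  obtain ⟨ρ₀, hρ₀, hρ₀le⟩ : ∃ ρ₀ : ℝ, 0 < ρ₀ ∧ ∀ p ∈ P, ∀ j, ρ₀ ≤ ρf p j := by
    refine ⟨(insert 1 ((P ×ˢ Finset.univ).image fun pj => ρf pj.1 pj.2)).min' (Finset.insert_nonempty _ _),
      (Finset.lt_min'_iff _ _).2 fun r hr => ?_, fun p hp j => Finset.min'_le _ _ ?_⟩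
    · rcases Finset.mem_insert.1 hr with rfl | hr
      · exact one_pos
      · obtain ⟨pj, -, rfl⟩ := Finset.mem_image.1 hr; exact hρf _ _
    · exact Finset.mem_insert_of_mem (Finset.mem_image.2 ⟨(p, j), Finset.mem_product.2 ⟨hp, Finset.mem_univ j⟩, rfl⟩)
  refine ⟨ρ₀, hρ₀, fun ρ hρ hρS => ?_⟩
  obtain ⟨φ, G, hφ0, hGφ, hGre, hG1, hφi, hφL⟩ := exists_normalisedRadialBump hρ
  choose I y κ g hg hy hκ happ using fun (p : ↥P) (j : Fin n) =>
    hitems p.1 j ρ hρ (hρS.trans (hρ₀le p.1 p.2 j)) φ G hφ0 hGφ hGre hG1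
  -- (4) the items, indexed by `Σ_{p ∈ P} ∏ⱼ Fin (I p j)`
  obtain ⟨N, ⟨ev⟩⟩ : ∃ N, Nonempty (Fin N ≃ Σ p : ↥P, ((j : Fin n) → Fin (I p j))) := ⟨_, ⟨(Fintype.equivFin _).symm⟩⟩
  refine ⟨φ, N, fun i j => y (ev i).1 j ((ev i).2 j), fun i j => ⇑(b (ev i).1.1.1 (ev i).1.1.2 j),
    fun i j => SchwartzMap.tensorFin 1 fun _ => G.mulComp (b (ev i).1.1.1 (ev i).1.1.2 j) _ _ hC,
    fun i => NuclearExpansion.coeff Λ (ev i).1.1.1 (ev i).1.1.2 F * ∏ j, κ (ev i).1 j ((ev i).2 j),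
    fun i => Φ (fun j => g (ev i).1 j ((ev i).2 j)) (b (ev i).1.1.1 (ev i).1.1.2), hφ0, hφi, hφL,
    fun i j x => by simp [hGφ], fun i x => by simp only [hΦ, hg], fun i => ?_, fun i j => ?_, ?_, fun kl hkl => ?_⟩
  · -- centres: ONE point `x_β ∈ supp F` in `β`'s box serves every slot, since `y ∈ supp a_{p,j}` is within `2` lattice
    -- units of `β`'s slot-`j` planar coordinates and `x_β` within `1`, i.e. `3` lattice units `= δ` in all
    obtain ⟨x, hx, hxβ⟩ := hBloc _ (Finset.mem_product.1 (ev i).1.2).1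
    have key : ∀ u v w : ℝ, |3 / δ * u - w| ≤ 2 → |3 / δ * v - w| ≤ 1 → |u - v| ≤ δ := fun u v w h1 h2 => by
      have h3 : |3 / δ * u - w - (3 / δ * v - w)| ≤ 3 := (abs_sub _ _).trans (by linarith)
      rw [show 3 / δ * u - w - (3 / δ * v - w) = 3 / δ * (u - v) by ring, abs_mul, abs_of_pos hσ] at h3
      exact le_of_mul_le_mul_left (h3.trans_eq (div_mul_cancel₀ (3 : ℝ) hδ.ne').symm) hσ
    refine ⟨x, hx, fun j => ?_⟩
    have hy' := hats _ _ j (hy (ev i).1 j ((ev i).2 j))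
    have h0 := hxβ (finProdFinEquiv (j, 0)); have h1 := hxβ (finProdFinEquiv (j, 1))
    rw [hΛ, Equiv.symm_apply_apply] at h0 h1
    exact ⟨key _ _ _ hy'.1 h0, key _ _ _ hy'.2 h1⟩
  · exact ⟨(hb _ _ j).1, (hb _ _ j).2.1.trans (le_max_left _ _), fun p => ((hb _ _ j).2.2 p).trans (le_max_right _ _)⟩
  · -- coefficient mass
    have hP1 : ∑ p ∈ P, ‖NuclearExpansion.coeff Λ p.1 p.2 F‖ ≤ B.card * M₁ := by
      rw [Finset.sum_product]
      exact (Finset.sum_le_sum fun β _ => hM₁ β _).trans (by rw [Finset.sum_const, nsmul_eq_mul])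
    have hpr : ∀ p : ↥P, ∑ ι : (j : Fin n) → Fin (I p j), ∏ j, ‖κ p j (ι j)‖ ≤ (A₀ + 1) ^ n := fun p => by
      rw [← Fintype.piFinset_univ, ← Finset.prod_univ_sum (fun _ => Finset.univ) fun j i => ‖κ p j i‖]
      exact (Finset.prod_le_prod (fun j _ => by positivity) fun j _ => show ∑ i, ‖κ p j i‖ ≤ A₀ + 1 from
        (hκ p j).trans (by linarith [haL p.1.1 p.1.2 j])).trans (by rw [Finset.prod_const, Finset.card_univ, Fintype.card_fin])
    beta_reduce
    rw [Equiv.sum_comp ev fun w => ‖NuclearExpansion.coeff Λ w.1.1.1 w.1.1.2 F * ∏ j, κ w.1 j (w.2 j)‖, Fintype.sum_sigma]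
    simp_rw [norm_mul, norm_prod, ← Finset.mul_sum]
    calc ∑ p : ↥P, ‖NuclearExpansion.coeff Λ p.1.1 p.1.2 F‖ * ∑ ι : (j : Fin n) → Fin (I p j), ∏ j, ‖κ p j (ι j)‖
        ≤ ∑ p : ↥P, ‖NuclearExpansion.coeff Λ p.1.1 p.1.2 F‖ * (A₀ + 1) ^ n :=
          Finset.sum_le_sum fun p _ => mul_le_mul_of_nonneg_left (hpr p) (norm_nonneg _)
      _ = (∑ p ∈ P, ‖NuclearExpansion.coeff Λ p.1 p.2 F‖) * (A₀ + 1) ^ n := by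
          rw [← Finset.sum_mul, Finset.sum_coe_sort P fun p => ‖NuclearExpansion.coeff Λ p.1 p.2 F‖]
      _ ≤ B.card * M₁ * (A₀ + 1) ^ n := by gcongr
  · -- approximation
    refine (Seminorm.le_finset_sup_apply (p := schwartzSeminormFamily ℂ (Fin n → E4) ℂ) hkl).trans_lt ?_
    have hsum : ∑ i, (NuclearExpansion.coeff Λ (ev i).1.1.1 (ev i).1.1.2 F * ∏ j, κ (ev i).1 j ((ev i).2 j)) •
        Φ (fun j => g (ev i).1 j ((ev i).2 j)) (b (ev i).1.1.1 (ev i).1.1.2) =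
        ∑ p : ↥P, NuclearExpansion.coeff Λ p.1.1 p.1.2 F • Φ (fun j => ∑ i, κ p j i • g p j i) (b p.1.1 p.1.2) := by
      rw [Equiv.sum_comp ev fun w => (NuclearExpansion.coeff Λ w.1.1.1 w.1.1.2 F * ∏ j, κ w.1 j (w.2 j)) •
        Φ (fun j => g w.1 j (w.2 j)) (b w.1.1.1 w.1.1.2), Fintype.sum_sigma]
      refine Finset.sum_congr rfl fun p _ => ?_
      simp_rw [mul_smul, ← Finset.smul_sum]
      congr 1; ext x
      simp only [hΦ, sum_apply, smul_apply, smul_eq_mul, Finset.sum_mul]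
      rw [Finset.prod_univ_sum]
      simp only [Fintype.piFinset_univ, mul_assoc, Finset.prod_mul_distrib]
    have h2 : q (∑ p : ↥P, NuclearExpansion.coeff Λ p.1.1 p.1.2 F •
        (Φ (a p.1.1 p.1.2) (b p.1.1 p.1.2) - Φ (fun j => ∑ i, κ p j i • g p j i) (b p.1.1 p.1.2))) ≤ η / 2 := by
      refine (Finset.le_sum_of_subadditive q (map_zero q).le (map_add_le_add q) _ _).trans ?_
      calc _ ≤ ∑ p : ↥P, ‖NuclearExpansion.coeff Λ p.1.1 p.1.2 F‖ * (η / 2 / (Ct + 1)) := Finset.sum_le_sum fun p _ => by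
              rw [map_smul_eq_mul]
              exact mul_le_mul_of_nonneg_left (hclose _ _ fun j kl hkl => happ p j kl hkl).le (norm_nonneg _)
        _ = Ct * (η / 2 / (Ct + 1)) := by rw [← Finset.sum_mul, Finset.sum_coe_sort P fun p => ‖NuclearExpansion.coeff Λ p.1 p.2 F‖]
        _ ≤ η / 2 := (mul_half_div_succ_lt hCt0 hη).le
    calc q (F - ∑ i, (NuclearExpansion.coeff Λ (ev i).1.1.1 (ev i).1.1.2 F * ∏ j, κ (ev i).1 j ((ev i).2 j)) •
          Φ (fun j => g (ev i).1 j ((ev i).2 j)) (b (ev i).1.1.1 (ev i).1.1.2))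
        = q ((F - ∑ p ∈ P, NuclearExpansion.coeff Λ p.1 p.2 F • NuclearExpansion.e Λ p.1 p.2) + ∑ p : ↥P,
            NuclearExpansion.coeff Λ p.1.1 p.1.2 F • (Φ (a p.1.1 p.1.2) (b p.1.1 p.1.2) - Φ (fun j => ∑ i, κ p j i • g p j i) (b p.1.1 p.1.2))) := by
          rw [hsum, ← Finset.sum_coe_sort P]
          simp_rw [hE, smul_sub, Finset.sum_sub_distrib]
          abel_nf
      _ ≤ _ := map_add_le_add q _ _
      _ < η / 2 + η / 2 := add_lt_add_of_lt_of_le hK h2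
      _ = η := by ring

end Summit.QuantumFields.YangMills.Theorems.SoftKernelBoostCovariance.Sketch
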